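import Summits.QuantumFields.YangMills.Theorems.ToronSmallBallToronCoreRaritySubQuartic
import Summits.QuantumFields.YangMills.Theorems.ToronSmallBallOffCoreStripWindow
import Summits.QuantumFields.YangMills.Theorems.ToronSmallBallAssemblyDeep
import HarnessLib

/-!
# `SwapTwistDeficit.TwistDeficitLaplaceWindow` (item stmt-QuantumFields-23776) — PROVED: route `ToronSmallBall` closes its leaf

Crux ⟨23776⟩ of route `SwapTwistDeficit` = the target leaf of route `ToronSmallBall` (LINE g12-A of ideator seat ym-idea-4): for SOME `a > 0` an
`L`-UNIFORM exponent `k` with `β^{−k} · Z_phys(2L) ≤ Z_phys(2L) − Z^S(2L)` on the zero-flux `L³ × 2L` torus for `β ≥ β₀`, `L₀ ≤ L ≤ β^a` (the swap-twist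
deficit on the Laplace window).  Every hypothesis of the deciding theorem `ToronSmallBall.closes` is now a kernel-checked theorem:
h₁ `ToronCoreRaritySubQuartic` ⟨23956⟩ (`ToronSmallBall.toronCoreRaritySubQuartic_proof`, via route `FluxSectorLaplace`: flux reflection + seam-axis
annulus shift), h₂ `OffCoreStripWindowDeep` ⟨23957⟩ (`ToronSmallBall.offCoreStripWindowDeep_proof`), `Assembly2` ⟨23958⟩ (`assemblyDeep_proof`).

HONEST FRAMING: the WINDOW half of `SwapTwistDeficit.TwistDeficit` ⟨23317⟩ only — the polynomial tail `TwistDeficitPolyTail` ⟨23777⟩ (Bałaban wall)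
is NOT touched; fixed-lattice transfer-matrix estimates; nothing about infinite volume, the continuum limit or the Clay Yang–Mills gap — the YM mass gap
is NOT proved.  No `sorry`, no new axiom, no new definition.  References: [cite: Luscher1983, §2]; [cite: tHooft1979]; [cite: MontvayMunster1994, (3.145)].
-/

set_option autoImplicit false

namespace Summit.QuantumFields.YangMills.Theorems.SwapTwistDeficit

/-- ★ **`SwapTwistDeficit.TwistDeficitLaplaceWindow` holds** (item stmt-QuantumFields-23776, BY NAME), through `ToronSmallBall.closes` fed with the
proved items of route `ToronSmallBall`.  The polynomial tail ⟨23777⟩ and the YM mass gap are NOT proved. [cite: Luscher1983, §2] [cite: tHooft1979] -/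
theorem twistDeficitLaplaceWindow_proof : Summit.QuantumFields.YangMills.Theses.SwapTwistDeficit.TwistDeficitLaplaceWindow :=
  Summit.QuantumFields.YangMills.Theses.ToronSmallBall.closes ToronSmallBall.toronCoreRaritySubQuartic_proof ToronSmallBall.offCoreStripWindowDeep_proof
    ToronSmallBall.assemblyDeep_proof

end Summit.QuantumFields.YangMills.Theorems.SwapTwistDeficit
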